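import Literature.MathematicalPhysics.QuantumFieldTheory.Balaban1983to89.B4Ineq112ZeroNestNegFace

/-!
# `Balaban1983to89.B4ThmZeroNestAlphaZero` — B4 THEOREM p. 573 AT THE ENDPOINT `α = 0` (A = 0): THE CONVENTION
# TRANSFER «bond-convention carrier at any `α` ⟹ b04's VERBATIM carrier at `α = 0`» FOR EVERY ZERO-FIELD INSTANCE,
# AND THE EXACT VERDICT «ON THE VERBATIM NESTED-BOX CARRIER `nestFamB` THE `α`-CLAUSE OF THE TYPED LEAF
# `B4.ThmPrinted` HOLDS IF AND ONLY IF `α = 0`» (the zero-field verdict table of nodes 16 · 17 completed; v1.1: the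
# converse comparison verbatim ⇒ bond at every `α`, the endpoint convention-free, the per-clause verdict for `0 < α < 1`)

**Source.** T. Bałaban, *Regularity and Decay of Lattice Green's Functions*, Commun. Math. Phys. **89**, 571–597
(1983) (bib key `Balaban1983RegularityDecay`, «B4»): p. 572 [PDF 2] (1.6); p. 573 [PDF 3] the Theorem («Proposition
2.1 of [1]») with (1.9)–(1.12) and its last sentence on rectangular parallelepipeds.  Quoted from the page renders
`b2b-balaban-ref1/pages/1983-cmp89-regularity-decay/1983-cmp89-regularity-decay-p002-x2.png`, `…-p003-x2.png` (read
as images, not from the OCR text); the print's `≦`, `≧` are written `≤`, `≥`.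

## WHAT IS PRINTED (verbatim from the renders)

p. 572: «G_k(Ω, A) = (−Δ^{η,N}_{A,Ω} + m² + aP_k(A))^{−1},   (1.6)  where m² ≥ 0 and a is a positive constant close
to 1.»   p. 573, top: «[Of course ∂^η_μ is a difference derivative defined by (∂^η_μ A)(x) = η^{−1}(A(x + ηe_μ) − A(x)).]»

p. 573, Theorem (Proposition 2.1 of [1]): «For α < 1 there exist positive constants δ₀, c₀, R₀ independent of
A, k, Ω and depending on d, M only, c₀ on α also, such that for e sufficiently small and for an arbitrary function
f : Ω → R^N, we have |x − x′|^{−α} |U(A(Γ_{x,x′}))(D^η_{A,μ}G_k(Ω, A)f)(x′) − (D^η_{A,μ}G_k(Ω, A)f)(x)|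
≤ c₀ exp(−δ₀ dist({x, x′}, supp f))‖f‖_∞   (1.9) for x, x′ ∈ Ω, and satisfying the condition
dist({x, x′}, Ω^c) ≥ R₀. Similarly |(D^η_{A,μ}G_k(Ω, A)f)(x)|, |(G_k(Ω, A)(x)|» ⟦sic: «(G_k(Ω, A)f)(x)» is meant⟧
«≤ c₀ exp(−δ₀ dist(x, supp f))‖f‖_∞   (1.10) for x ∈ Ω, dist(x, Ω^c) ≥ R₀. If Ω ⊂ Ω₀, then for δG_k(Ω, Ω₀, A)
defined by the equality δG_k(Ω, Ω₀, A) = G_k(Ω, A) − G_k(Ω₀, A),   (1.11)  we have the inequalities (1.5) and (1.6)»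
⟦sic: (1.9) and (1.10) are meant⟧ «(with the same restrictions on x, x′) with the additional factor
exp(−δ₀ dist(supp f, Ω^c) − δ₀ dist(supp f, Ω^c))   (1.12)  on the right hand sides. For some simple sets Ω, e.g. for
rectangular parallelepipeds, the inequalities hold without any restrictions on the points x, x′, i.e. for all
x, x′ ∈ Ω.»

THE TYPED READING (cell's DAG, b04; untouched): `B4.ThmPrinted fam := ∀ α < 1, ∃ δ₀ c₀ R₀ e₁ > 0, ∀ i, regular →
bigBlocks → 0 < e ≤ e₁ → Ineq19_110 (fam i) α δ₀ c₀ R₀ ∧ Ineq111_112 (fam i) α δ₀ c₀ R₀`; below, «the `α`-CLAUSE» of a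
family is the inner `∃ …` package at a fixed real `α`.  b04's zero-field carrier `zeroFieldSettingB a Mb g i`
(`B4Cor23ZeroEta`) has the UNGUARDED Hölder fields `lhs19 α μ f x x′ = |x − x′|_η^{−α}·|fdiff μ (Gf) x′ − fdiff μ (Gf) x|`
(`fdiff := 0` where the forward bond leaves `Ω`), `dlhs19` likewise with `δG`; node 12's `zeroFieldSettingBond a Mb g i`
(`B4Ineq19ZeroBoxEta`) has IDENTICAL fields except `lhs19`/`dlhs19 := holderQ …` (the bond convention).

## WHAT IS CERTIFIED (HONEST SCOPE)

THE CASE `A = 0` (`U ≡ 1`, `D^η_{0,μ}`), operator (1.6) `G_k(Ω,0) = (−Δ^{η,N}_Ω + m² + aP_k)^{-1}` (b04's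
`(fineOpR n a m² R)⁻¹`).  §2 is about EVERY zero-field instance `i : ZeroFieldInstance d` (any `Ω ⊂ Ω₀`); §3–§5 are
read on node 13's NESTED-BOX FAMILY `NestInst d ℓ m²₊` (`B4Ineq111ZeroNestEta`; mesh `η = L^{-k}`, `L = ℓ + 1 ≥ 2`)
through b04's VERBATIM carrier `nestFamB ℓ m²₊ a Mb g i = zeroFieldSettingB a Mb g i.toZF` — b04's files untouched.

* THE TRANSFER AT `α = 0` (§2, every instance, every `a`, `Mb`, `g`; `δ₀, c₀ ≥ 0`):
  `Ineq19_110 (zeroFieldSettingBond a Mb g i) α δ₀ c₀ R₀ → Ineq19_110 (zeroFieldSettingB a Mb g i) 0 δ₀ (2c₀) R₀`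
  (`ineq19_110_zero_of_bond`) and the same for `Ineq111_112` (`ineq111_112_zero_of_bond`).  Mechanism: at weight
  `|x − x′|_η^{−0} = 1` the unguarded two-point field is `|D(x′) − D(x)| ≤ |D(x′)| + |D(x)|`; the one-point clauses
  (1.10), (1.10)·(1.12) are literally the same fields in both carriers (only the second conjuncts of the
  hypothesis are used, the exponent `α` of the hypothesis is immaterial); and `dist({x,x′}, ·) ≤ dist(x, ·),
  dist(x′, ·)` for the support and for `Ω₀∖Ω` (node 14's `setDist_mono_left`) converts the one-point exponentials
  into the two-point ones.  Hence `leafClause_zero_of_bond`: over ANY index `φ : I → ZeroFieldInstance d`, an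
  `α`-clause of the bond-convention family yields the `α = 0` clause of the verbatim family (constants
  `δ₀, 2c₀, R₀, e₁`); in particular `ThmPrintedNN (zeroFieldSettingBond a Mb g) →` the `α = 0` clause of b04's own
  `zeroFieldSettingB a Mb g` over ALL instances (`leafClause_zero_of_thmPrintedNN_bond`; CONDITIONAL — its antecedent,
  the Theorem at `A = 0` on general regions in the bond convention, is not in the tree).
* `α = 0` HOLDS ON `nestFamB` (§3): from node 13's `thm_nestFam` (bond convention, `0 ≤ α < 1`, nested boxes) at
  `α = 0` and the transfer: `ineq_zero_nestFamB` — ONE pair `δ₀, c₀ > 0` with (1.9)–(1.12) at `α = 0` for EVERY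
  threshold `R₀` and EVERY member (no antecedent used; `g` admissible, `g ≤ dist_η(supp f, Ω₀∖Ω)`), and the
  `α = 0` clause of the leaf `leafClause_zero` (`R₀ = e₁ = 1`).
* `α < 0` FAILS ON `nestFamB` (§4): node 16's (O-α) witness as the member `cube` of the nested index (scale `k`,
  `Ω = Ω₀ =` the cube of `N^{d+1}` big blocks, offset `0`, mass `0`, charge `e`; antecedents met, `cube_hypotheses`,
  `cube_rect`): `ineq19_cube_fails` is node 16's `ineq19B_fails` read through the fields of `nestFamB` (node 16's
  core estimates `core_lhs_ge`, `core_src_le`, `rhs_le_abs` are statements on the fine cube and apply verbatim: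
  `f = (−Δ^{η,N}_Ω + aP_k)1_{y_μ = n−1}`, `x = (n−1)e_μ`, `x′ = (nMb·N − 2)e_μ`, weight `≥ (Mb·N − 2)^{−α} → ∞`);
  `exists_member_violating_neg`, `leafClause_fails_neg` (every `α < 0`, every boundary assignment `g`).
* THE VERDICT (§5) `leafClause_nestFamB_iff`: for every `L ≥ 2`, `a > 0`, `m²₊ ≥ 0`, `Mb ≥ 1` and every `g` with
  `0 ≤ g ≤ dist_η(supp f, Ω₀∖Ω)` (nonnegative and admissible), and EVERY REAL `α`:
  «the `α`-clause holds on `nestFamB ℓ m²₊ a Mb g`» `↔ α = 0` (`α < 0`: §4; `α > 0`: node 17's `leafClause_fails`;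
  `α = 0`: §3).  `leafClause_nestFamB_std_iff`: the same for b04's default `g = bdist` (`nestFamB … bdist` =
  `B4Cor23ZeroEta.zeroFieldSetting` on the nested instances).  `carriers_on_printed_range`: for `0 ≤ α < 1` the
  clause HOLDS in the bond convention (`nestFam`, node 13) while in the verbatim carrier it holds iff `α = 0`.
  Non-vacuity at `d + 1 = 4`, `L = 2`, `a = 1`, `m²₊ = 0`, `Mb = 1` (§6).
* THE CONVERSE COMPARISON (§7, v1.1; every instance, EVERY `α`, SAME constants): node 12's guarded quotient
  `holderQ` is `≤` b04's unguarded quotient pointwise (`holderQ_le_quot`: equal on two bonds of `Ω`, `0 ≤ ·` off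
  them), hence `Ineq19_110 (zeroFieldSettingB a Mb g i) α δ₀ c₀ R₀ → Ineq19_110 (zeroFieldSettingBond a Mb g i) α δ₀
  c₀ R₀` (`ineq19_110_bond_of_B`) and the same for `Ineq111_112` (`ineq111_112_bond_of_B`); over any index `φ` the
  `α`-clause, the leaf `B4.ThmPrinted` and node 13's `ThmPrintedNN` transfer from the verbatim carrier to the bond
  convention (`leafClause_bond_of_B`, `thmPrinted_bond_of_B`, `thmPrintedNN_bond_of_B`).  With §2: THE ENDPOINT IS
  CONVENTION-FREE — over ANY index of zero-field instances the `α = 0` clause holds in the bond convention iff it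
  holds in the verbatim carrier (`leafClause_zero_bond_iff_B`; `c₀ ↦ 2c₀` forward, unchanged backward).
* THE PER-CLAUSE VERDICT ON `nestFamB` FOR `0 < α < 1` (§8, v1.1): the verbatim (1.9)–(1.10) HOLD with one pair of
  constants (`ineq19_110_nestFamB`, all `0 ≤ α < 1`: node 14's `ineq19_110_boxFamB`, since `nestFamB … i = boxFamB …
  i.toBox` definitionally); the full (1.11)–(1.12) hold in the bond convention (node 13 `thm_nestFam`; so the two
  one-point (1.10)·(1.12) clauses — identical fields — hold verbatim, node 13 `ineq112_nestFamB`); and for EVERY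
  choice of constants some member meeting the antecedents violates the verbatim `Ineq111_112` (node 17
  `exists_member_violating`): `perClause_nestFamB`, and in one line `ineq19_not_ineq111_nestFamB` (uniform constants
  exist for the verbatim `Ineq19_110`, none for the verbatim `Ineq111_112`).  So for `0 < α < 1` the failure of §5
  sits in the unguarded `δG`-Hölder field (1.11) ALONE (the `G`-Hölder field (1.9) is unguarded too, but at a face of
  the box `Ω` the Neumann reflection makes the artificial `0` harmless — node 14).
* THE READING (for b04 / the carver; the kernel facts are the items above).  The zero-field verdict table of the
  typed leaf on b04's verbatim nested-box carrier is now complete: `α < 0` false (node 16: the literal range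
  «α < 1» admits negative exponents; the print means the Hölder range `0 ≤ α < 1`), `α > 0` false (node 17: the
  point-versus-bond convention of `fdiff`/`lhs19` at a face of `Ω` interior to `Ω₀`), `α = 0` TRUE (this file: at
  the endpoint the Hölder clause degenerates into a two-point form of the decay bound (1.10)/(1.10)·(1.12), which is
  insensitive to the bond/point convention).  So exactly ONE clause of `B4.ThmPrinted` survives at zero field in the
  verbatim carrier on nested boxes, and what survives is the DECAY content, not the Hölder regularity; the printed
  theorem itself (bond statement, `0 ≤ α < 1`) is certified TRUE at `A = 0` on the same family in node 13's
  convention (`thm_nestFam`), and at the endpoint the two conventions are equivalent (§7); for `0 < α < 1` the verbatim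
  defect is confined to the `δG`-Hölder clause (§8).  Statements about the TYPED TRANSCRIPTION, not against the paper.

NOT certified / not claimed: anything at `A ≠ 0`; the `α = 0` clause of b04's verbatim carrier over ALL zero-field
instances (general regions `Ω ⊂ Ω₀`: only the conditional transfer of §2 is given — the bond-side Theorem at `A = 0`
on general regions is not in the tree); in the verdict, boundary assignments `g` with negative values or violating
admissibility (the `α > 0` direction needs `0 ≤ g`, node 17; the `α = 0` direction needs `g ≤ bdist`, node 13; the
`α < 0` direction holds for every `g`); the constants depend on `d, L, a` (node 12/13's `valG_bound`-type bounds) —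
the print's «depending on d, M only» is not tracked, as everywhere in this lineage; no optimality of `2c₀`; in §8
nothing is said about a hypothetical `R₀`-RESTRICTED reading of the verbatim (1.11) (the typed antecedent is met on
boxes through b04's `rect` disjunct — the print's parallelepiped waiver —, so node 17's face witness, at distance `η`
from `Ω₀∖Ω`, is admissible; whether the unguarded field obeys (1.11) away from the interior faces is not decided here).

DICTIONARY (print ↦ Lean, all from b04 / nodes 12, 13, 16, 17): `Ω ⊂ Ω₀` ↦ `boxDom (fun j ↦ L^k·M j) ⊂
shiftBox L^k M₀ s` (`NestInst.toZF`), for the member `cube`: `M = M₀ = (Mb·N, …, Mb·N)`, `s = 0`; `G_k(Ω,0)` ↦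
`i.green a = (fineOpR n a m² R)⁻¹`; `δG_k(Ω,Ω₀,0)` ↦ `B4Cor23ZeroDelta.dG`; `D^η_{0,μ}` ↦ `fdiff n R μ` (verbatim
carrier) / `holderQ` (bond convention); `|x − x′|` ↦ `edistR n R`, `|x − x′|^{−α}` at `α = 0` ↦ `edistR … ^ (−0) = 1`
(`rpow_neg_zero_eq_one`); `‖f‖_∞` ↦ `ZeroFieldInstance.supN`; `dist(x, supp f)`, `dist({x,x′}, supp f)` ↦ `sdist1`,
`sdist2` (`setDist (edistR n R) {x} (supp f)`, `… ({x} ∪ {x′}) …`); `dist(·, Ω^c)` ↦ `bdist1`, `bdist2` (to `Ω₀∖Ω =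
outR R R₀` in `Ω₀`'s metric); the factor (1.12) ↦ `exp(−(δ₀·bdist + δ₀·g i f))`; `U(A(Γ)) ↦ 1`; (1.9)·(1.10) ↦
`B4.Ineq19_110`, (1.11)·(1.12) ↦ `B4.Ineq111_112`; the Theorem ↦ `B4.ThmPrinted`, its `0 ≤ α < 1` restriction ↦
node 13's `ThmPrintedNN`.

DEPENDENCIES (kernel-proved tree modules only; no Literature fact is minted, no hypothesis is assumed): node 17
`B4Ineq112ZeroNestNegFace` (`leafClause_fails`, `exists_member_violating`, `bdist_nonneg`), node 16 `B4Thm19ZeroBoxNegAlpha` (`src`, `near_mem`,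
`far_mem`, `core_lhs_ge`, `core_src_le`, `rhs_le_abs`, `negN_spec`, `three_le_negN`, `one_le_Mb_negN`, `two_le_Lk`,
`two_le_MbN`, `supN_le_of_forall_le`), node 14 `B4Ineq19ZeroBoxFace` (`setDist_mono_left`, `ineq19_110_boxFamB`), node 13
`B4Ineq111ZeroNestEta` (`NestInst`, `nestFam`, `nestFamB`, `thm_nestFam`, `ineq111_112_bond_iff`, `shiftBox`,
`shiftBox_isBlockUnion_of_dvd`, `boxDom_isBlockUnion_of_dvd`, `ThmPrintedNN`, `bdist_admissible`), node 12
`B4Ineq19ZeroBoxEta` (`zeroFieldSettingBond`, `holderQ`, `boxFamB`, `ineq19_110_bond_iff`, `ineq19_110_B_iff`, `BoxInst.rect`,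
`BoxInst.one_le_Lk`, `supN_nonneg`, `setDist_edistR_nonneg`), b04's `B4` (`Ineq19_110`, `Ineq111_112`, `ThmPrinted`,
`EtaSetting`), `B4Cor23ZeroEta` (`ZeroFieldInstance`, `zeroFieldSettingB`, `zeroFieldSetting`), `B4Cor23ZeroDelta`
(`dG`, `setDist`, `bdist`, `outR`, `incl`), `B4Cor23Zero` (`fdiff`, `supp`, `edistR_nonneg`), `B4Lower18` (`IsBlockUnion`, `edistR`),
`B4TwoBox120` (`Fits`), `B4Reflection242` (`boxDom`); Mathlib otherwise.

VERSIONS: v1 (p189253, commit 42abe35f1051): §§1–6.  v1.1 (this file, ADDITIVE — every v1 declaration unchanged in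
statement and proof): §7 (the converse comparison verbatim ⇒ bond at every `α`, same constants, every instance;
the endpoint `α = 0` is convention-free on every family) and §8 (the per-clause verdict on `nestFamB` for
`0 < α < 1`: verbatim (1.9)–(1.10) true, verbatim (1.11)–(1.12) false for every choice of constants), with two
further `example`s; three `open` lists extended (`holderQ`, `boxFamB`, `ineq19_110_boxFamB`, `exists_member_violating`).

Value = the endpoint case closing the zero-field verdict table of the cell's typed p. 573 leaf on b04's verbatim
nested-box carrier (true exactly at `α = 0`), with the general `α = 0` convention-transfer theorem for every
zero-field instance (an equivalence of the two typed conventions at the endpoint, v1.1) and the per-clause location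
of the verbatim defect for `0 < α < 1` (v1.1); negative/positive knowledge for b04 / the carver about the typed transcription; NOT summit
progress and NOT a claim against B4's Theorem.
-/

namespace Literature.MathematicalPhysics.QuantumFieldTheory.Balaban1983to89.B4ThmZeroNestAlphaZero

open Finset Matrix
open Literature.MathematicalPhysics.QuantumFieldTheory.Balaban1983to89.B4 (EtaSetting Ineq19_110 Ineq111_112
  ThmPrinted)
open Literature.MathematicalPhysics.QuantumFieldTheory.Balaban1983to89.B4Reflection242 (boxDom)
open Literature.MathematicalPhysics.QuantumFieldTheory.Balaban1983to89.B4Lower18 (IsBlockUnion edistR)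
open Literature.MathematicalPhysics.QuantumFieldTheory.Balaban1983to89.B4TwoBox120 (Fits)
open Literature.MathematicalPhysics.QuantumFieldTheory.Balaban1983to89.B4Cor23Zero (fdiff supp)
open Literature.MathematicalPhysics.QuantumFieldTheory.Balaban1983to89.B4Cor23ZeroDelta (setDist outR incl bdist)
open Literature.MathematicalPhysics.QuantumFieldTheory.Balaban1983to89.B4Cor23ZeroEta (ZeroFieldInstance
  zeroFieldSettingB zeroFieldSetting)
open Literature.MathematicalPhysics.QuantumFieldTheory.Balaban1983to89.B4Ineq19ZeroBoxEta (BoxInst boxFamB holderQ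
  setDist_edistR_nonneg supN_nonneg zeroFieldSettingBond ineq19_110_bond_iff ineq19_110_B_iff)
open Literature.MathematicalPhysics.QuantumFieldTheory.Balaban1983to89.B4Ineq19ZeroBoxFace (setDist_mono_left
  ineq19_110_boxFamB)
open Literature.MathematicalPhysics.QuantumFieldTheory.Balaban1983to89.B4Ineq111ZeroNestEta (shiftBox
  shiftBox_isBlockUnion_of_dvd boxDom_isBlockUnion_of_dvd NestInst nestFam nestFamB ThmPrintedNN thm_nestFam
  ineq111_112_bond_iff bdist_admissible)
open Literature.MathematicalPhysics.QuantumFieldTheory.Balaban1983to89.B4Thm19ZeroBoxNegAlpha (src near_mem far_mem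
  core_lhs_ge core_src_le rhs_le_abs negN_spec three_le_negN one_le_Mb_negN two_le_Lk two_le_MbN
  supN_le_of_forall_le)
open Literature.MathematicalPhysics.QuantumFieldTheory.Balaban1983to89.B4Ineq112ZeroNestNegFace (leafClause_fails
  exists_member_violating bdist_nonneg)

noncomputable section

variable {d : ℕ}

/-! ## §1 Elementary inequalities: the weight at `α = 0`, exponential weights, combining two one-point bounds -/

/-- `t ^ (−0) = 1`: at the endpoint `α = 0` the Hölder weight `|x − x′|_η^{−α}` is `1`. [folklore] -/
theorem rpow_neg_zero_eq_one (t : ℝ) : t ^ (-(0 : ℝ)) = 1 := by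
  rw [neg_zero, Real.rpow_zero]

/-- monotonicity of the decay factor `e^{−δs}` in the distance (`δ ≥ 0`). [folklore] -/
theorem exp_weight_mono {δ s s' : ℝ} (hδ : 0 ≤ δ) (h : s' ≤ s) : Real.exp (-(δ * s)) ≤ Real.exp (-(δ * s')) :=
  Real.exp_le_exp.2 (neg_le_neg (mul_le_mul_of_nonneg_left h hδ))

/-- the same with an added term (the shape of the (1.12) factor `e^{−(δ·dist + δ·dist(supp f, Ω^c))}`). [folklore] -/
theorem exp_weight_mono_add {δ s s' t : ℝ} (hδ : 0 ≤ δ) (h : s' ≤ s) :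
    Real.exp (-(δ * s + t)) ≤ Real.exp (-(δ * s' + t)) :=
  Real.exp_le_exp.2 (by nlinarith [mul_le_mul_of_nonneg_left h hδ])

/-- **COMBINING TWO ONE-POINT BOUNDS INTO THE TWO-POINT BOUND AT WEIGHT `1`** (three-factor shape of (1.9)):
`|p| ≤ cEF`, `|q| ≤ cE′F`, `E, E′ ≤ G` ⟹ `1·|p − q| ≤ 2cGF`. [folklore] -/
theorem combine3 {w p q c E E' G F : ℝ} (hw : w = 1) (hc : 0 ≤ c) (hF : 0 ≤ F)
    (hp : |p| ≤ c * E * F) (hq : |q| ≤ c * E' * F) (hE : E ≤ G) (hE' : E' ≤ G) :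
    w * |p - q| ≤ 2 * c * G * F := by
  have h1 : c * E * F ≤ c * G * F := mul_le_mul_of_nonneg_right (mul_le_mul_of_nonneg_left hE hc) hF
  have h2 : c * E' * F ≤ c * G * F := mul_le_mul_of_nonneg_right (mul_le_mul_of_nonneg_left hE' hc) hF
  obtain ⟨hp1, hp2⟩ := abs_le.1 (hp.trans h1)
  obtain ⟨hq1, hq2⟩ := abs_le.1 (hq.trans h2)
  rw [hw, one_mul]
  exact abs_le.2 ⟨by linarith, by linarith⟩

/-- the four-factor shape of (1.11)·(1.12): `|p| ≤ cE₁E₂F`, `|q| ≤ cE₁′E₂′F`, `E₁, E₁′ ≤ G₁`, `E₂, E₂′ ≤ G₂`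
⟹ `1·|p − q| ≤ 2cG₁G₂F`. [folklore] -/
theorem combine4 {w p q c E₁ E₁' G₁ E₂ E₂' G₂ F : ℝ} (hw : w = 1) (hc : 0 ≤ c) (hF : 0 ≤ F)
    (hp : |p| ≤ c * E₁ * E₂ * F) (hq : |q| ≤ c * E₁' * E₂' * F)
    (h1 : E₁ ≤ G₁) (h1' : E₁' ≤ G₁) (h2 : E₂ ≤ G₂) (h2' : E₂' ≤ G₂) (hE₂ : 0 ≤ E₂) (hE₂' : 0 ≤ E₂')
    (hG₁ : 0 ≤ G₁) : w * |p - q| ≤ 2 * c * G₁ * G₂ * F := by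
  have a1 : c * E₁ * E₂ * F ≤ c * G₁ * G₂ * F := by
    refine mul_le_mul_of_nonneg_right ?_ hF
    calc c * E₁ * E₂ ≤ c * G₁ * E₂ := mul_le_mul_of_nonneg_right (mul_le_mul_of_nonneg_left h1 hc) hE₂
      _ ≤ c * G₁ * G₂ := mul_le_mul_of_nonneg_left h2 (mul_nonneg hc hG₁)
  have a2 : c * E₁' * E₂' * F ≤ c * G₁ * G₂ * F := by
    refine mul_le_mul_of_nonneg_right ?_ hF
    calc c * E₁' * E₂' ≤ c * G₁ * E₂' := mul_le_mul_of_nonneg_right (mul_le_mul_of_nonneg_left h1' hc) hE₂'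
      _ ≤ c * G₁ * G₂ := mul_le_mul_of_nonneg_left h2' (mul_nonneg hc hG₁)
  obtain ⟨hp1, hp2⟩ := abs_le.1 (hp.trans a1)
  obtain ⟨hq1, hq2⟩ := abs_le.1 (hq.trans a2)
  rw [hw, one_mul]
  exact abs_le.2 ⟨by linarith, by linarith⟩

/-- weakening the constant of a one-point bound, three factors. [folklore] -/
theorem weak3 {P c c' E F : ℝ} (hcc : c ≤ c') (hE : 0 ≤ E) (hF : 0 ≤ F) (h : P ≤ c * E * F) :
    P ≤ c' * E * F :=
  h.trans (mul_le_mul_of_nonneg_right (mul_le_mul_of_nonneg_right hcc hE) hF)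

/-- weakening the constant of a one-point bound, four factors. [folklore] -/
theorem weak4 {P c c' E₁ E₂ F : ℝ} (hcc : c ≤ c') (hE₁ : 0 ≤ E₁) (hE₂ : 0 ≤ E₂) (hF : 0 ≤ F)
    (h : P ≤ c * E₁ * E₂ * F) : P ≤ c' * E₁ * E₂ * F :=
  h.trans (mul_le_mul_of_nonneg_right (mul_le_mul_of_nonneg_right (mul_le_mul_of_nonneg_right hcc hE₁) hE₂) hF)

/-! ## §2 The convention transfer at the endpoint `α = 0`, for EVERY zero-field instance -/

section Carrier

variable (a : ℝ) (Mb : ℕ) (g : ∀ i : ZeroFieldInstance d, (↥i.R → ℝ) → ℝ) (i : ZeroFieldInstance d)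

/-- `dist_η({x, x′}, supp f) ≤ dist_η(x, supp f)` (the typed `sdist2 ≤ sdist1` at the first point). [folklore] -/
theorem sdist2_le_left (x x' : ↥i.R) (f : ↥i.R → ℝ) :
    setDist (edistR i.n i.R) ({x} ∪ {x'}) (supp f) ≤ setDist (edistR i.n i.R) {x} (supp f) :=
  setDist_mono_left _ Finset.subset_union_left (Finset.singleton_nonempty x)

/-- `dist_η({x, x′}, supp f) ≤ dist_η(x′, supp f)`. [folklore] -/
theorem sdist2_le_right (x x' : ↥i.R) (f : ↥i.R → ℝ) :
    setDist (edistR i.n i.R) ({x} ∪ {x'}) (supp f) ≤ setDist (edistR i.n i.R) {x'} (supp f) :=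
  setDist_mono_left _ Finset.subset_union_right (Finset.singleton_nonempty x')

/-- `dist_η({x, x′}, Ω₀∖Ω) ≤ dist_η(x, Ω₀∖Ω)` (the typed `bdist2 ≤ bdist1` at the first point). [folklore] -/
theorem bdist2_le_left (x x' : ↥i.R) :
    setDist (edistR i.n i.R₀) ({incl i.hsub x} ∪ {incl i.hsub x'}) (outR i.R i.R₀) ≤
      setDist (edistR i.n i.R₀) {incl i.hsub x} (outR i.R i.R₀) :=
  setDist_mono_left _ Finset.subset_union_left (Finset.singleton_nonempty _)

/-- `dist_η({x, x′}, Ω₀∖Ω) ≤ dist_η(x′, Ω₀∖Ω)`. [folklore] -/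
theorem bdist2_le_right (x x' : ↥i.R) :
    setDist (edistR i.n i.R₀) ({incl i.hsub x} ∪ {incl i.hsub x'}) (outR i.R i.R₀) ≤
      setDist (edistR i.n i.R₀) {incl i.hsub x'} (outR i.R i.R₀) :=
  setDist_mono_left _ Finset.subset_union_right (Finset.singleton_nonempty _)

/-- **`B4.Ineq111_112` READ ON b04's VERBATIM CARRIER, UNFOLDED** (by `Iff.rfl`): the typed (1.11)–(1.12) of
instance `i` with the UNGUARDED Hölder field `dlhs19 α μ f x x′ = |x − x′|_η^{−α}·|D_μδG f(x′) − D_μδG f(x)|`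
(`D_μ = B4Cor23Zero.fdiff`, `δG = B4Cor23ZeroDelta.dG`). [cite: Balaban1983RegularityDecay, Theorem p. 573
(1.11)–(1.12), case A = 0, dictionary] -/
theorem ineq111_112_B_iff (α δ₀ c₀ R₀ : ℝ) :
    Ineq111_112 (zeroFieldSettingB a Mb g i) α δ₀ c₀ R₀ ↔
      (∀ (μ : Fin (d + 1)) (f : ↥i.R → ℝ) (x x' : ↥i.R),
          ((zeroFieldSettingB a Mb g i).rect ∨ R₀ ≤ (zeroFieldSettingB a Mb g i).bdist2 x x') →
          edistR i.n i.R x x' ^ (-α) *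
              |fdiff i.n i.R μ (B4Cor23ZeroDelta.dG i.n a i.m2 i.hsub f) x' -
                fdiff i.n i.R μ (B4Cor23ZeroDelta.dG i.n a i.m2 i.hsub f) x| ≤
            c₀ * Real.exp (-(δ₀ * setDist (edistR i.n i.R) ({x} ∪ {x'}) (supp f))) *
              Real.exp (-(δ₀ * setDist (edistR i.n i.R₀) ({incl i.hsub x} ∪ {incl i.hsub x'}) (outR i.R i.R₀)
                + δ₀ * g i f)) * i.supN f) ∧
      (∀ (μ : Fin (d + 1)) (f : ↥i.R → ℝ) (x : ↥i.R),
          ((zeroFieldSettingB a Mb g i).rect ∨ R₀ ≤ (zeroFieldSettingB a Mb g i).bdist1 x) →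
          |fdiff i.n i.R μ (B4Cor23ZeroDelta.dG i.n a i.m2 i.hsub f) x| ≤
              c₀ * Real.exp (-(δ₀ * setDist (edistR i.n i.R) {x} (supp f))) *
                Real.exp (-(δ₀ * setDist (edistR i.n i.R₀) {incl i.hsub x} (outR i.R i.R₀) + δ₀ * g i f)) *
                  i.supN f ∧
            |B4Cor23ZeroDelta.dG i.n a i.m2 i.hsub f x| ≤
              c₀ * Real.exp (-(δ₀ * setDist (edistR i.n i.R) {x} (supp f))) *
                Real.exp (-(δ₀ * setDist (edistR i.n i.R₀) {incl i.hsub x} (outR i.R i.R₀) + δ₀ * g i f)) *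
                  i.supN f) :=
  Iff.rfl

/-- **THE CONVENTION TRANSFER AT `α = 0` FOR (1.9)–(1.10)**, every zero-field instance `i` (ANY region
`Ω ⊂ Ω₀`): if node 12's bond-convention carrier satisfies the typed `Ineq19_110` at some exponent `α` with constants
`(δ₀, c₀, R₀)`, `δ₀, c₀ ≥ 0`, then b04's VERBATIM carrier satisfies it at the exponent `0` with `(δ₀, 2c₀, R₀)`:
at weight `|x − x′|_η^{0} = 1` the unguarded two-point field is `|D_μGf(x′) − D_μGf(x)| ≤ |D_μGf(x′)| + |D_μGf(x)|`,
each bounded by the (1.10) clause (identical in both carriers), and `dist({x,x′}, supp f) ≤ dist(x, supp f)`.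
[cite: Balaban1983RegularityDecay, Theorem p. 573 (1.9)–(1.10), case A = 0, endpoint α = 0 of the typed Hölder
clause in the verbatim carrier] -/
theorem ineq19_110_zero_of_bond {α δ₀ c₀ R₀ : ℝ} (hδ : 0 ≤ δ₀) (hc : 0 ≤ c₀)
    (h : Ineq19_110 (zeroFieldSettingBond a Mb g i) α δ₀ c₀ R₀) :
    Ineq19_110 (zeroFieldSettingB a Mb g i) 0 δ₀ (2 * c₀) R₀ := by
  have h2 := ((ineq19_110_bond_iff a Mb g i α δ₀ c₀ R₀).1 h).2
  have hcc : c₀ ≤ 2 * c₀ := by linarith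
  refine (ineq19_110_B_iff a Mb g i 0 δ₀ (2 * c₀) R₀).2 ⟨fun μ f x x' hr => ?_, fun μ f x hr => ⟨?_, ?_⟩⟩
  · have dx := (h2 μ f x (hr.imp_right fun h' => h'.trans (bdist2_le_left i x x'))).1
    have dx' := (h2 μ f x' (hr.imp_right fun h' => h'.trans (bdist2_le_right i x x'))).1
    exact combine3 (rpow_neg_zero_eq_one _) hc (supN_nonneg i f) dx' dx
      (exp_weight_mono hδ (sdist2_le_right i x x' f)) (exp_weight_mono hδ (sdist2_le_left i x x' f))
  · exact weak3 hcc (Real.exp_pos _).le (supN_nonneg i f) (h2 μ f x hr).1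
  · exact weak3 hcc (Real.exp_pos _).le (supN_nonneg i f) (h2 μ f x hr).2

/-- **THE CONVENTION TRANSFER AT `α = 0` FOR (1.11)–(1.12)**, every zero-field instance `i`: if the bond-convention
carrier satisfies the typed `Ineq111_112` at some `α` with `(δ₀, c₀, R₀)`, `δ₀, c₀ ≥ 0`, then b04's VERBATIM carrier
satisfies it at `α = 0` with `(δ₀, 2c₀, R₀)` — `|D_μδGf(x′) − D_μδGf(x)| ≤ |D_μδGf(x′)| + |D_μδGf(x)|`, the two
(1.10)·(1.12) clauses (identical fields, node 13 `ineq112_B_of_bond`), `dist({x,x′}, ·) ≤ dist(x, ·)` for both the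
support and `Ω₀∖Ω`. [cite: Balaban1983RegularityDecay, Theorem p. 573 (1.11)–(1.12), case A = 0, endpoint α = 0 of
the typed Hölder clause in the verbatim carrier] -/
theorem ineq111_112_zero_of_bond {α δ₀ c₀ R₀ : ℝ} (hδ : 0 ≤ δ₀) (hc : 0 ≤ c₀)
    (h : Ineq111_112 (zeroFieldSettingBond a Mb g i) α δ₀ c₀ R₀) :
    Ineq111_112 (zeroFieldSettingB a Mb g i) 0 δ₀ (2 * c₀) R₀ := by
  have h2 := ((ineq111_112_bond_iff a Mb g i α δ₀ c₀ R₀).1 h).2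
  have hcc : c₀ ≤ 2 * c₀ := by linarith
  refine (ineq111_112_B_iff a Mb g i 0 δ₀ (2 * c₀) R₀).2 ⟨fun μ f x x' hr => ?_, fun μ f x hr => ⟨?_, ?_⟩⟩
  · have dx := (h2 μ f x (hr.imp_right fun h' => h'.trans (bdist2_le_left i x x'))).1
    have dx' := (h2 μ f x' (hr.imp_right fun h' => h'.trans (bdist2_le_right i x x'))).1
    exact combine4 (rpow_neg_zero_eq_one _) hc (supN_nonneg i f) dx' dx
      (exp_weight_mono hδ (sdist2_le_right i x x' f)) (exp_weight_mono hδ (sdist2_le_left i x x' f))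
      (exp_weight_mono_add hδ (bdist2_le_right i x x')) (exp_weight_mono_add hδ (bdist2_le_left i x x'))
      (Real.exp_pos _).le (Real.exp_pos _).le (Real.exp_pos _).le
  · exact weak4 hcc (Real.exp_pos _).le (Real.exp_pos _).le (supN_nonneg i f) (h2 μ f x hr).1
  · exact weak4 hcc (Real.exp_pos _).le (Real.exp_pos _).le (supN_nonneg i f) (h2 μ f x hr).2

end Carrier

/-- **THE `α = 0` CLAUSE OF THE TYPED LEAF TRANSFERS FROM THE BOND CONVENTION TO THE VERBATIM CARRIER** over ANY
index of zero-field instances `φ : I → ZeroFieldInstance d` (any regions): if some `α`-clause of `B4.ThmPrinted`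
holds for `j ↦ zeroFieldSettingBond a Mb g (φ j)`, then the `α = 0` clause holds for `j ↦ zeroFieldSettingB a Mb g
(φ j)` (constants `δ₀, 2c₀, R₀, e₁`; the antecedents `regular`, `bigBlocks`, `e` are the same fields). [folklore] -/
theorem leafClause_zero_of_bond {I : Type*} (φ : I → ZeroFieldInstance d) (a : ℝ) (Mb : ℕ)
    (g : ∀ i : ZeroFieldInstance d, (↥i.R → ℝ) → ℝ) {α : ℝ}
    (h : ∃ δ₀ c₀ R₀ e₁ : ℝ, 0 < δ₀ ∧ 0 < c₀ ∧ 0 < R₀ ∧ 0 < e₁ ∧ ∀ j : I,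
      (zeroFieldSettingBond a Mb g (φ j)).regular → (zeroFieldSettingBond a Mb g (φ j)).bigBlocks →
        0 < (zeroFieldSettingBond a Mb g (φ j)).e → (zeroFieldSettingBond a Mb g (φ j)).e ≤ e₁ →
          Ineq19_110 (zeroFieldSettingBond a Mb g (φ j)) α δ₀ c₀ R₀ ∧
            Ineq111_112 (zeroFieldSettingBond a Mb g (φ j)) α δ₀ c₀ R₀) :
    ∃ δ₀ c₀ R₀ e₁ : ℝ, 0 < δ₀ ∧ 0 < c₀ ∧ 0 < R₀ ∧ 0 < e₁ ∧ ∀ j : I,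
      (zeroFieldSettingB a Mb g (φ j)).regular → (zeroFieldSettingB a Mb g (φ j)).bigBlocks →
        0 < (zeroFieldSettingB a Mb g (φ j)).e → (zeroFieldSettingB a Mb g (φ j)).e ≤ e₁ →
          Ineq19_110 (zeroFieldSettingB a Mb g (φ j)) 0 δ₀ c₀ R₀ ∧
            Ineq111_112 (zeroFieldSettingB a Mb g (φ j)) 0 δ₀ c₀ R₀ := by
  obtain ⟨δ₀, c₀, R₀, e₁, hδ, hc, hR, he, H⟩ := h
  refine ⟨δ₀, 2 * c₀, R₀, e₁, hδ, by linarith, hR, he, fun j hreg hbig he0 he1 => ?_⟩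
  obtain ⟨h1, h2⟩ := H j hreg hbig he0 he1
  exact ⟨ineq19_110_zero_of_bond a Mb g (φ j) hδ.le hc.le h1, ineq111_112_zero_of_bond a Mb g (φ j) hδ.le hc.le h2⟩

/-- in particular over b04's OWN index (all zero-field instances, `φ = id`): IF the restricted leaf `ThmPrintedNN`
holds in node 12's bond convention, then the `α = 0` clause of `B4.ThmPrinted` holds on b04's verbatim carrier
`zeroFieldSettingB a Mb g` itself. (Conditional: the antecedent is the Theorem at `A = 0` for general regions, not
proved in the tree.) [folklore] -/
theorem leafClause_zero_of_thmPrintedNN_bond (a : ℝ) (Mb : ℕ) (g : ∀ i : ZeroFieldInstance d, (↥i.R → ℝ) → ℝ)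
    (h : ThmPrintedNN (zeroFieldSettingBond a Mb g : ZeroFieldInstance d → EtaSetting)) :
    ∃ δ₀ c₀ R₀ e₁ : ℝ, 0 < δ₀ ∧ 0 < c₀ ∧ 0 < R₀ ∧ 0 < e₁ ∧ ∀ i : ZeroFieldInstance d,
      (zeroFieldSettingB a Mb g i).regular → (zeroFieldSettingB a Mb g i).bigBlocks →
        0 < (zeroFieldSettingB a Mb g i).e → (zeroFieldSettingB a Mb g i).e ≤ e₁ →
          Ineq19_110 (zeroFieldSettingB a Mb g i) 0 δ₀ c₀ R₀ ∧ Ineq111_112 (zeroFieldSettingB a Mb g i) 0 δ₀ c₀ R₀ :=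
  leafClause_zero_of_bond id a Mb g (h 0 le_rfl one_pos)

/-! ## §3 The `α = 0` clause HOLDS on the verbatim nested-box family `nestFamB` -/

section Family

variable {ℓ : ℕ} {m2plus : ℝ}

/-- **(1.9)–(1.12) AT `α = 0` IN b04's VERBATIM CARRIER ON THE NESTED-BOX FAMILY**, one pair of constants, every
threshold `R₀` and every member (no antecedent used): from node 13's `thm_nestFam` (bond convention, `α = 0`) by the
transfer of §2. [cite: Balaban1983RegularityDecay, Theorem p. 573 (1.9)–(1.12), case A = 0, Ω ⊂ Ω₀ boxes, α = 0] -/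
theorem ineq_zero_nestFamB (hℓ : 1 ≤ ℓ) {a : ℝ} (ha : 0 < a) (Mb : ℕ)
    {g : ∀ i : ZeroFieldInstance d, (↥i.R → ℝ) → ℝ}
    (hg : ∀ (i : ZeroFieldInstance d) (f : ↥i.R → ℝ),
      (outR i.R i.R₀).Nonempty → (supp f).Nonempty → g i f ≤ bdist i.n i.hsub f) :
    ∃ δ₀ c₀ : ℝ, 0 < δ₀ ∧ 0 < c₀ ∧ ∀ (R₀ : ℝ) (i : NestInst d ℓ m2plus),
      Ineq19_110 (nestFamB ℓ m2plus a Mb g i) 0 δ₀ c₀ R₀ ∧ Ineq111_112 (nestFamB ℓ m2plus a Mb g i) 0 δ₀ c₀ R₀ := by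
  obtain ⟨δ₀, c₀, hδ, hc, h⟩ := thm_nestFam (m2plus := m2plus) hℓ a ha Mb hg 0 le_rfl one_pos
  exact ⟨δ₀, 2 * c₀, hδ, by linarith, fun R₀ i =>
    ⟨ineq19_110_zero_of_bond a Mb g i.toZF hδ.le hc.le (h R₀ i).1,
      ineq111_112_zero_of_bond a Mb g i.toZF hδ.le hc.le (h R₀ i).2⟩⟩

/-- **THE `α = 0` CLAUSE OF THE TYPED LEAF `B4.ThmPrinted` HOLDS ON `nestFamB`** (every `L ≥ 2`, `a > 0`, mass
window, `Mb`, admissible `g`): positive `δ₀, c₀, R₀, e₁` with (1.9)–(1.12) at `α = 0` for every member meeting the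
antecedents (which are not used; `R₀ = e₁ = 1`). [cite: Balaban1983RegularityDecay, Theorem p. 573 (1.9)–(1.12),
case A = 0, Ω ⊂ Ω₀ boxes, α = 0, verbatim carrier] -/
theorem leafClause_zero (hℓ : 1 ≤ ℓ) {a : ℝ} (ha : 0 < a) (Mb : ℕ)
    {g : ∀ i : ZeroFieldInstance d, (↥i.R → ℝ) → ℝ}
    (hg : ∀ (i : ZeroFieldInstance d) (f : ↥i.R → ℝ),
      (outR i.R i.R₀).Nonempty → (supp f).Nonempty → g i f ≤ bdist i.n i.hsub f) :
    ∃ δ₀ c₀ R₀ e₁ : ℝ, 0 < δ₀ ∧ 0 < c₀ ∧ 0 < R₀ ∧ 0 < e₁ ∧ ∀ i : NestInst d ℓ m2plus,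
      (nestFamB ℓ m2plus a Mb g i).regular → (nestFamB ℓ m2plus a Mb g i).bigBlocks →
        0 < (nestFamB ℓ m2plus a Mb g i).e → (nestFamB ℓ m2plus a Mb g i).e ≤ e₁ →
          Ineq19_110 (nestFamB ℓ m2plus a Mb g i) 0 δ₀ c₀ R₀ ∧
            Ineq111_112 (nestFamB ℓ m2plus a Mb g i) 0 δ₀ c₀ R₀ := by
  obtain ⟨δ₀, c₀, hδ, hc, h⟩ := ineq_zero_nestFamB (m2plus := m2plus) hℓ ha Mb hg
  exact ⟨δ₀, c₀, 1, 1, hδ, hc, one_pos, one_pos, fun i _ _ _ _ => h 1 i⟩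

/-! ## §4 The `α < 0` clauses FAIL on `nestFamB` (node 16's (O-α) witness as a member of the nested family) -/

/-- a box fits in itself with offset `0`. [folklore] -/
theorem fits_self (M : Fin (d + 1) → ℕ) : Fits M M (fun _ => 0) := fun _ => ⟨le_rfl, by simp⟩

/-- **THE WITNESS MEMBER FOR `α < 0`**: scale `k`, `Ω = Ω₀ =` the cube `[0, Mb·N)^{d+1}` of `N^{d+1}` big blocks
(offset `0`), mass `0`, charge `e` — node 16's `bigCube` as a member of the nested-box index. [cite:
Balaban1983RegularityDecay, §1 pp. 572–573, case A = 0, Ω = Ω₀ a cube of big blocks] -/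
def cube (ℓ : ℕ) {m2plus : ℝ} (hm2 : 0 ≤ m2plus) (k : ℕ) (hk : 1 ≤ k) (Mb N : ℕ) (hMN : 1 ≤ Mb * N) (e : ℝ) :
    NestInst d ℓ m2plus where
  k := k
  hk := hk
  M := fun _ => Mb * N
  M0 := fun _ => Mb * N
  s := fun _ => 0
  hs := fits_self _
  hM := fun _ => hMN
  m2 := 0
  hm := le_rfl
  hm' := hm2
  e := e

/-- THE WITNESS MEETS EVERY TYPED ANTECEDENT: `regular`, `bigBlocks` (`Ω` and `Ω₀` are unions of big blocks of
side `Mb`), charge `e`. [folklore] -/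
theorem cube_hypotheses (hm2 : 0 ≤ m2plus) (a : ℝ) (g : ∀ i : ZeroFieldInstance d, (↥i.R → ℝ) → ℝ) (k : ℕ)
    (hk : 1 ≤ k) {Mb N : ℕ} (hMb : 1 ≤ Mb) (hMN : 1 ≤ Mb * N) (e : ℝ) :
    (nestFamB ℓ m2plus a Mb g (cube ℓ hm2 k hk Mb N hMN e)).regular ∧
      (nestFamB ℓ m2plus a Mb g (cube ℓ hm2 k hk Mb N hMN e)).bigBlocks ∧
      (nestFamB ℓ m2plus a Mb g (cube ℓ hm2 k hk Mb N hMN e)).e = e := by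
  have hMn : 1 ≤ Mb * (ℓ + 1) ^ k := by simpa using Nat.mul_le_mul hMb (BoxInst.one_le_Lk ℓ k)
  have h1 : IsBlockUnion (Mb * (ℓ + 1) ^ k) (boxDom fun _ : Fin (d + 1) => (ℓ + 1) ^ k * (Mb * N)) :=
    boxDom_isBlockUnion_of_dvd hMn fun _ => ⟨N, by ring⟩
  have h2 : IsBlockUnion (Mb * (ℓ + 1) ^ k) (shiftBox ((ℓ + 1) ^ k) (fun _ : Fin (d + 1) => Mb * N)
      fun _ => (0 : ℤ)) :=
    shiftBox_isBlockUnion_of_dvd hMn (fun _ => ⟨N, by ring⟩) (fun _ => ⟨0, by simp⟩)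
  exact ⟨trivial, ⟨h1, h2⟩, rfl⟩

/-- the cube is a rectangular parallelepiped (node 12's `BoxInst.rect`). [folklore] -/
theorem cube_rect (hm2 : 0 ≤ m2plus) (a : ℝ) (g : ∀ i : ZeroFieldInstance d, (↥i.R → ℝ) → ℝ) (k : ℕ)
    (hk : 1 ≤ k) (Mb N : ℕ) (hMN : 1 ≤ Mb * N) (e : ℝ) :
    (nestFamB ℓ m2plus a Mb g (cube ℓ hm2 k hk Mb N hMN e)).rect :=
  BoxInst.rect a Mb g (cube ℓ hm2 k hk Mb N hMN e).toBox

/-- **(1.9) FAILS FOR `α < 0` ON THE MEMBER** (node 16's core estimates `core_lhs_ge`, `core_src_le` on the fine cube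
read through the fields of `nestFamB`): for ANY `δ₀ ≥ 0`, `R₀`, if `|c₀|·(4(d+1)n² + a) < (Mb·N − 2)^{−α}·n` then
`Ineq19_110` is violated at `f = (−Δ^{η,N}_Ω + aP_k)1_{y_μ = n−1}`, `x = (n−1)e_μ`, `x′ = (nMb·N − 2)e_μ`. [folklore] -/
theorem ineq19_cube_fails (hℓ : 1 ≤ ℓ) (hm2 : 0 ≤ m2plus) {a : ℝ} (ha : 0 < a) {Mb : ℕ} (hMb : 1 ≤ Mb)
    (g : ∀ i : ZeroFieldInstance d, (↥i.R → ℝ) → ℝ) (k : ℕ) (hk : 1 ≤ k) {N : ℕ} (hN : 2 ≤ N)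
    (hMN : 1 ≤ Mb * N) (e : ℝ) (μ : Fin (d + 1)) {α : ℝ} (hα : α < 0) {δ₀ : ℝ} (hδ : 0 ≤ δ₀) {c₀ : ℝ}
    (hc : |c₀| * (4 * ((d : ℝ) + 1) * (((ℓ + 1) ^ k : ℕ) : ℝ) ^ 2 + a) <
      (((Mb * N : ℕ) : ℝ) - 2) ^ (-α) * (((ℓ + 1) ^ k : ℕ) : ℝ)) (R₀ : ℝ) :
    ¬ Ineq19_110 (nestFamB ℓ m2plus a Mb g (cube ℓ hm2 k hk Mb N hMN e)) α δ₀ c₀ R₀ := by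
  intro h
  have hn : 2 ≤ (ℓ + 1) ^ k := two_le_Lk hℓ hk
  have hT : 2 ≤ Mb * N := two_le_MbN hMb hN
  have h1 := h.1 μ (src ((ℓ + 1) ^ k) (Mb * N) a μ) ⟨_, near_mem hn hT μ⟩ ⟨_, far_mem hn hT μ⟩
    (Or.inl (cube_rect hm2 a g k hk Mb N hMN e))
  have h2 : (((Mb * N : ℕ) : ℝ) - 2) ^ (-α) * (((ℓ + 1) ^ k : ℕ) : ℝ) ≤
      (nestFamB ℓ m2plus a Mb g (cube ℓ hm2 k hk Mb N hMN e)).lhs19 α μ (src ((ℓ + 1) ^ k) (Mb * N) a μ)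
        ⟨_, near_mem hn hT μ⟩ ⟨_, far_mem hn hT μ⟩ :=
    core_lhs_ge hn hT ha μ hα.le
  have hF0 : 0 ≤ 4 * ((d : ℝ) + 1) * (((ℓ + 1) ^ k : ℕ) : ℝ) ^ 2 + a := by positivity
  have hsup : (nestFamB ℓ m2plus a Mb g (cube ℓ hm2 k hk Mb N hMN e)).supNorm (src ((ℓ + 1) ^ k) (Mb * N) a μ) ≤
      4 * ((d : ℝ) + 1) * (((ℓ + 1) ^ k : ℕ) : ℝ) ^ 2 + a :=
    supN_le_of_forall_le (i := (cube ℓ hm2 k hk Mb N hMN e).toZF) _ hF0 fun y => core_src_le hn hT ha μ y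
  have hsup0 : 0 ≤ (nestFamB ℓ m2plus a Mb g (cube ℓ hm2 k hk Mb N hMN e)).supNorm
      (src ((ℓ + 1) ^ k) (Mb * N) a μ) :=
    supN_nonneg (cube ℓ hm2 k hk Mb N hMN e).toZF _
  have hs : 0 ≤ (nestFamB ℓ m2plus a Mb g (cube ℓ hm2 k hk Mb N hMN e)).sdist2
      ⟨_, near_mem hn hT μ⟩ ⟨_, far_mem hn hT μ⟩ (src ((ℓ + 1) ^ k) (Mb * N) a μ) := setDist_edistR_nonneg _ _
  have h3 := rhs_le_abs (c₀ := c₀) hδ hs hsup0 hsup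
  exact lt_irrefl _ (((h2.trans h1).trans h3).trans_lt hc)

/-- **A MEMBER VIOLATING (1.9), FOR EVERY `α < 0` AND EVERY CHOICE OF CONSTANTS** (verbatim carrier, nested index):
the cube of `N(d, L, a, c₀, α)` big blocks per side at scale `1`, `Ω₀ = Ω`, charge `e₁`. [cite:
Balaban1983RegularityDecay, Theorem p. 573 (1.9), case A = 0 — the literal range «α < 1» of the typed leaf read with
α < 0; node 16's (O-α)] -/
theorem exists_member_violating_neg (hℓ : 1 ≤ ℓ) (hm2 : 0 ≤ m2plus) {a : ℝ} (ha : 0 < a) {Mb : ℕ} (hMb : 1 ≤ Mb)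
    (g : ∀ i : ZeroFieldInstance d, (↥i.R → ℝ) → ℝ) {α : ℝ} (hα : α < 0) {δ₀ : ℝ} (hδ : 0 ≤ δ₀)
    (c₀ R₀ e₁ : ℝ) :
    ∃ i : NestInst d ℓ m2plus, (nestFamB ℓ m2plus a Mb g i).regular ∧ (nestFamB ℓ m2plus a Mb g i).bigBlocks ∧
      (nestFamB ℓ m2plus a Mb g i).e = e₁ ∧ ¬ Ineq19_110 (nestFamB ℓ m2plus a Mb g i) α δ₀ c₀ R₀ := by
  have hMN := one_le_Mb_negN hMb d ((ℓ + 1) ^ 1) a c₀ α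
  obtain ⟨hreg, hbig, hee⟩ := cube_hypotheses (ℓ := ℓ) hm2 a g 1 le_rfl hMb hMN e₁
  exact ⟨_, hreg, hbig, hee, ineq19_cube_fails hℓ hm2 ha hMb g 1 le_rfl
    (le_trans (by norm_num) (three_le_negN d _ a c₀ α)) hMN e₁ 0 hα hδ
    (negN_spec d (BoxInst.one_le_Lk ℓ 1) ha c₀ hα hMb) R₀⟩

/-- **NO CONSTANTS AT ALL FOR `α < 0`** on `nestFamB`. [folklore] -/
theorem leafClause_fails_neg (hℓ : 1 ≤ ℓ) (hm2 : 0 ≤ m2plus) {a : ℝ} (ha : 0 < a) {Mb : ℕ} (hMb : 1 ≤ Mb)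
    (g : ∀ i : ZeroFieldInstance d, (↥i.R → ℝ) → ℝ) {α : ℝ} (hα : α < 0) :
    ¬ ∃ δ₀ c₀ R₀ e₁ : ℝ, 0 < δ₀ ∧ 0 < c₀ ∧ 0 < R₀ ∧ 0 < e₁ ∧ ∀ i : NestInst d ℓ m2plus,
      (nestFamB ℓ m2plus a Mb g i).regular → (nestFamB ℓ m2plus a Mb g i).bigBlocks →
        0 < (nestFamB ℓ m2plus a Mb g i).e → (nestFamB ℓ m2plus a Mb g i).e ≤ e₁ →
          Ineq19_110 (nestFamB ℓ m2plus a Mb g i) α δ₀ c₀ R₀ ∧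
            Ineq111_112 (nestFamB ℓ m2plus a Mb g i) α δ₀ c₀ R₀ := by
  rintro ⟨δ₀, c₀, R₀, e₁, hδ, _, _, he, H⟩
  obtain ⟨i, hreg, hbig, hee, hnot⟩ := exists_member_violating_neg hℓ hm2 ha hMb g hα hδ.le c₀ R₀ e₁
  exact hnot (H i hreg hbig (hee ▸ he) hee.le).1

/-! ## §5 THE EXACT VERDICT: on `nestFamB` the `α`-clause of the typed leaf holds if and only if `α = 0` -/

/-- **THE ZERO-FIELD VERDICT TABLE OF THE TYPED p. 573 LEAF ON b04's VERBATIM NESTED-BOX CARRIER.**  For every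
`L ≥ 2`, `a > 0`, mass ceiling `m²₊ ≥ 0`, big-block size `Mb ≥ 1` and boundary assignment `g` with
`0 ≤ g ≤ dist_η(supp f, Ω₀∖Ω)` (admissible and nonnegative), and every real `α`: the `α`-clause of `B4.ThmPrinted`
«∃ δ₀ c₀ R₀ e₁ > 0, ∀ members meeting the antecedents, (1.9)–(1.12)» holds on `nestFamB` IF AND ONLY IF `α = 0` —
`α < 0` fails by node 16's (O-α) cube witness (§4), `α > 0` fails by node 17's (O-bond) face witness
(`B4Ineq112ZeroNestNegFace.leafClause_fails`), `α = 0` holds by §3.  [cite: Balaban1983RegularityDecay, Theorem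
p. 573 (1.9)–(1.12), case A = 0, Ω ⊂ Ω₀ boxes — exact range of validity of the typed transcription's α-clause in
the verbatim carrier; NOT a statement about the printed theorem, whose Hölder range is 0 ≤ α < 1 on bonds] -/
theorem leafClause_nestFamB_iff (hℓ : 1 ≤ ℓ) (hm2 : 0 ≤ m2plus) {a : ℝ} (ha : 0 < a) {Mb : ℕ} (hMb : 1 ≤ Mb)
    {g : ∀ i : ZeroFieldInstance d, (↥i.R → ℝ) → ℝ} (hg0 : ∀ i f, 0 ≤ g i f)
    (hg1 : ∀ (i : ZeroFieldInstance d) (f : ↥i.R → ℝ),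
      (outR i.R i.R₀).Nonempty → (supp f).Nonempty → g i f ≤ bdist i.n i.hsub f) (α : ℝ) :
    (∃ δ₀ c₀ R₀ e₁ : ℝ, 0 < δ₀ ∧ 0 < c₀ ∧ 0 < R₀ ∧ 0 < e₁ ∧ ∀ i : NestInst d ℓ m2plus,
      (nestFamB ℓ m2plus a Mb g i).regular → (nestFamB ℓ m2plus a Mb g i).bigBlocks →
        0 < (nestFamB ℓ m2plus a Mb g i).e → (nestFamB ℓ m2plus a Mb g i).e ≤ e₁ →
          Ineq19_110 (nestFamB ℓ m2plus a Mb g i) α δ₀ c₀ R₀ ∧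
            Ineq111_112 (nestFamB ℓ m2plus a Mb g i) α δ₀ c₀ R₀) ↔ α = 0 := by
  refine ⟨fun h => ?_, fun h => ?_⟩
  · rcases lt_trichotomy α 0 with hα | hα | hα
    · exact absurd h (leafClause_fails_neg hℓ hm2 ha hMb g hα)
    · exact hα
    · exact absurd h (leafClause_fails hℓ hm2 ha hMb hg0 hα)
  · subst h
    exact leafClause_zero hℓ ha Mb hg1

/-- **THE VERDICT ON b04's DEFAULT CARRIER** (`g = dist_η(supp f, Ω₀∖Ω)`, i.e. `nestFamB … bdist` =
`B4Cor23ZeroEta.zeroFieldSetting` read on the nested-box instances): the `α`-clause holds iff `α = 0`. [folklore] -/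
theorem leafClause_nestFamB_std_iff (hℓ : 1 ≤ ℓ) (hm2 : 0 ≤ m2plus) {a : ℝ} (ha : 0 < a) {Mb : ℕ} (hMb : 1 ≤ Mb)
    (α : ℝ) :
    (∃ δ₀ c₀ R₀ e₁ : ℝ, 0 < δ₀ ∧ 0 < c₀ ∧ 0 < R₀ ∧ 0 < e₁ ∧ ∀ i : NestInst d ℓ m2plus,
      (nestFamB ℓ m2plus a Mb (fun i f => bdist i.n i.hsub f) i).regular →
        (nestFamB ℓ m2plus a Mb (fun i f => bdist i.n i.hsub f) i).bigBlocks →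
        0 < (nestFamB ℓ m2plus a Mb (fun i f => bdist i.n i.hsub f) i).e →
          (nestFamB ℓ m2plus a Mb (fun i f => bdist i.n i.hsub f) i).e ≤ e₁ →
          Ineq19_110 (nestFamB ℓ m2plus a Mb (fun i f => bdist i.n i.hsub f) i) α δ₀ c₀ R₀ ∧
            Ineq111_112 (nestFamB ℓ m2plus a Mb (fun i f => bdist i.n i.hsub f) i) α δ₀ c₀ R₀) ↔ α = 0 :=
  leafClause_nestFamB_iff hℓ hm2 ha hMb (fun i f => bdist_nonneg i f) bdist_admissible α

/-- **THE TWO CARRIERS SIDE BY SIDE ON THE PRINTED HÖLDER RANGE**: for `0 ≤ α < 1` the `α`-clause HOLDS in node 13's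
bond convention (`nestFam`, `thm_nestFam`), while in b04's verbatim carrier (`nestFamB`) it holds iff `α = 0`.
[folklore] -/
theorem carriers_on_printed_range (hℓ : 1 ≤ ℓ) (hm2 : 0 ≤ m2plus) {a : ℝ} (ha : 0 < a) {Mb : ℕ} (hMb : 1 ≤ Mb)
    {g : ∀ i : ZeroFieldInstance d, (↥i.R → ℝ) → ℝ} (hg0 : ∀ i f, 0 ≤ g i f)
    (hg1 : ∀ (i : ZeroFieldInstance d) (f : ↥i.R → ℝ),
      (outR i.R i.R₀).Nonempty → (supp f).Nonempty → g i f ≤ bdist i.n i.hsub f)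
    {α : ℝ} (hα0 : 0 ≤ α) (hα1 : α < 1) :
    (∃ δ₀ c₀ : ℝ, 0 < δ₀ ∧ 0 < c₀ ∧ ∀ (R₀ : ℝ) (i : NestInst d ℓ m2plus),
      Ineq19_110 (nestFam ℓ m2plus a Mb g i) α δ₀ c₀ R₀ ∧ Ineq111_112 (nestFam ℓ m2plus a Mb g i) α δ₀ c₀ R₀) ∧
    ((∃ δ₀ c₀ R₀ e₁ : ℝ, 0 < δ₀ ∧ 0 < c₀ ∧ 0 < R₀ ∧ 0 < e₁ ∧ ∀ i : NestInst d ℓ m2plus,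
      (nestFamB ℓ m2plus a Mb g i).regular → (nestFamB ℓ m2plus a Mb g i).bigBlocks →
        0 < (nestFamB ℓ m2plus a Mb g i).e → (nestFamB ℓ m2plus a Mb g i).e ≤ e₁ →
          Ineq19_110 (nestFamB ℓ m2plus a Mb g i) α δ₀ c₀ R₀ ∧
            Ineq111_112 (nestFamB ℓ m2plus a Mb g i) α δ₀ c₀ R₀) ↔ α = 0) :=
  ⟨thm_nestFam (m2plus := m2plus) hℓ a ha Mb hg1 α hα0 hα1, leafClause_nestFamB_iff hℓ hm2 ha hMb hg0 hg1 α⟩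

end Family

/-! ## §6 Non-vacuity: the verdict at `d + 1 = 4`, `L = 2`, `a = 1`, `m²₊ = 0`, `Mb = 1`, default carrier -/

section

/-- (1.9)–(1.12) at `α = 0` hold verbatim on the four-dimensional nested-box family, one pair of constants. -/
example : ∃ δ₀ c₀ : ℝ, 0 < δ₀ ∧ 0 < c₀ ∧ ∀ (R₀ : ℝ) (i : NestInst 3 1 0),
    Ineq19_110 (nestFamB (d := 3) 1 0 1 1 (fun i f => bdist i.n i.hsub f) i) 0 δ₀ c₀ R₀ ∧
      Ineq111_112 (nestFamB (d := 3) 1 0 1 1 (fun i f => bdist i.n i.hsub f) i) 0 δ₀ c₀ R₀ :=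
  ineq_zero_nestFamB (d := 3) (m2plus := 0) le_rfl one_pos 1 bdist_admissible

/-- the verdict table on the four-dimensional default family: the `α`-clause holds iff `α = 0`. -/
example (α : ℝ) :
    (∃ δ₀ c₀ R₀ e₁ : ℝ, 0 < δ₀ ∧ 0 < c₀ ∧ 0 < R₀ ∧ 0 < e₁ ∧ ∀ i : NestInst 3 1 0,
      (nestFamB (d := 3) 1 0 1 1 (fun i f => bdist i.n i.hsub f) i).regular →
        (nestFamB (d := 3) 1 0 1 1 (fun i f => bdist i.n i.hsub f) i).bigBlocks →
        0 < (nestFamB (d := 3) 1 0 1 1 (fun i f => bdist i.n i.hsub f) i).e →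
          (nestFamB (d := 3) 1 0 1 1 (fun i f => bdist i.n i.hsub f) i).e ≤ e₁ →
          Ineq19_110 (nestFamB (d := 3) 1 0 1 1 (fun i f => bdist i.n i.hsub f) i) α δ₀ c₀ R₀ ∧
            Ineq111_112 (nestFamB (d := 3) 1 0 1 1 (fun i f => bdist i.n i.hsub f) i) α δ₀ c₀ R₀) ↔ α = 0 :=
  leafClause_nestFamB_std_iff (d := 3) (m2plus := 0) le_rfl le_rfl one_pos le_rfl α

/-- the `α = −1` clause fails on the four-dimensional family (every boundary assignment). -/
example (g : ∀ i : ZeroFieldInstance 3, (↥i.R → ℝ) → ℝ) :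
    ¬ ∃ δ₀ c₀ R₀ e₁ : ℝ, 0 < δ₀ ∧ 0 < c₀ ∧ 0 < R₀ ∧ 0 < e₁ ∧ ∀ i : NestInst 3 1 0,
      (nestFamB (d := 3) 1 0 1 1 g i).regular → (nestFamB (d := 3) 1 0 1 1 g i).bigBlocks →
        0 < (nestFamB (d := 3) 1 0 1 1 g i).e → (nestFamB (d := 3) 1 0 1 1 g i).e ≤ e₁ →
          Ineq19_110 (nestFamB (d := 3) 1 0 1 1 g i) (-1) δ₀ c₀ R₀ ∧
            Ineq111_112 (nestFamB (d := 3) 1 0 1 1 g i) (-1) δ₀ c₀ R₀ :=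
  leafClause_fails_neg (d := 3) (m2plus := 0) le_rfl le_rfl one_pos le_rfl g (by norm_num)

end

/-! ## §7 (v1.1) The converse comparison: the verbatim carrier implies the bond carrier at EVERY `α`, same constants;
at the endpoint `α = 0` the two conventions are equivalent -/

section Converse

variable (a : ℝ) (Mb : ℕ) (g : ∀ i : ZeroFieldInstance d, (↥i.R → ℝ) → ℝ) (i : ZeroFieldInstance d)

/-- node 12's GUARDED Hölder quotient (bond convention: `0` unless both `⟨x, x+e_μ⟩`, `⟨x′, x′+e_μ⟩` are bonds of `Ω`)
is dominated pointwise by b04's UNGUARDED quotient `|x − x′|_η^{−α}·|D_μψ(x′) − D_μψ(x)|` (equal on two bonds,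
`0 ≤ ·` otherwise), for every real `α`. [folklore] -/
theorem holderQ_le_quot (n : ℕ) (R : Finset (Fin (d + 1) → ℤ)) (α : ℝ) (μ : Fin (d + 1)) (ψ : ↥R → ℝ)
    (x x' : ↥R) :
    holderQ n R α μ ψ x x' ≤ edistR n R x x' ^ (-α) * |fdiff n R μ ψ x' - fdiff n R μ ψ x| := by
  unfold holderQ
  split_ifs
  · exact le_rfl
  · exact mul_nonneg (Real.rpow_nonneg (B4Cor23Zero.edistR_nonneg x x') _) (abs_nonneg _)

/-- **VERBATIM ⇒ BOND FOR (1.9)–(1.10), EVERY `α`, SAME CONSTANTS**, every zero-field instance `i` (any region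
`Ω ⊂ Ω₀`): b04's verbatim carrier bounds the unguarded quotient, which dominates node 12's guarded one; the (1.10)
clauses are identical fields. [cite: Balaban1983RegularityDecay, Theorem p. 573 (1.9)–(1.10), case A = 0, the two
typed conventions compared] -/
theorem ineq19_110_bond_of_B {α δ₀ c₀ R₀ : ℝ} (h : Ineq19_110 (zeroFieldSettingB a Mb g i) α δ₀ c₀ R₀) :
    Ineq19_110 (zeroFieldSettingBond a Mb g i) α δ₀ c₀ R₀ := by
  have h' := (ineq19_110_B_iff a Mb g i α δ₀ c₀ R₀).1 h
  exact (ineq19_110_bond_iff a Mb g i α δ₀ c₀ R₀).2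
    ⟨fun μ f x x' hr => (holderQ_le_quot _ _ α μ _ x x').trans (h'.1 μ f x x' hr), h'.2⟩

/-- **VERBATIM ⇒ BOND FOR (1.11)–(1.12), EVERY `α`, SAME CONSTANTS**, every zero-field instance `i`.
[cite: Balaban1983RegularityDecay, Theorem p. 573 (1.11)–(1.12), case A = 0, the two typed conventions compared] -/
theorem ineq111_112_bond_of_B {α δ₀ c₀ R₀ : ℝ} (h : Ineq111_112 (zeroFieldSettingB a Mb g i) α δ₀ c₀ R₀) :
    Ineq111_112 (zeroFieldSettingBond a Mb g i) α δ₀ c₀ R₀ := by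
  have h' := (ineq111_112_B_iff a Mb g i α δ₀ c₀ R₀).1 h
  exact (ineq111_112_bond_iff a Mb g i α δ₀ c₀ R₀).2
    ⟨fun μ f x x' hr => (holderQ_le_quot _ _ α μ _ x x').trans (h'.1 μ f x x' hr), h'.2⟩

end Converse

/-- **THE `α`-CLAUSE OF THE TYPED LEAF TRANSFERS FROM THE VERBATIM CARRIER TO THE BOND CONVENTION** over ANY index
of zero-field instances `φ : I → ZeroFieldInstance d`, at the SAME `α` and with the SAME constants. [folklore] -/
theorem leafClause_bond_of_B {I : Type*} (φ : I → ZeroFieldInstance d) (a : ℝ) (Mb : ℕ)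
    (g : ∀ i : ZeroFieldInstance d, (↥i.R → ℝ) → ℝ) {α : ℝ}
    (h : ∃ δ₀ c₀ R₀ e₁ : ℝ, 0 < δ₀ ∧ 0 < c₀ ∧ 0 < R₀ ∧ 0 < e₁ ∧ ∀ j : I,
      (zeroFieldSettingB a Mb g (φ j)).regular → (zeroFieldSettingB a Mb g (φ j)).bigBlocks →
        0 < (zeroFieldSettingB a Mb g (φ j)).e → (zeroFieldSettingB a Mb g (φ j)).e ≤ e₁ →
          Ineq19_110 (zeroFieldSettingB a Mb g (φ j)) α δ₀ c₀ R₀ ∧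
            Ineq111_112 (zeroFieldSettingB a Mb g (φ j)) α δ₀ c₀ R₀) :
    ∃ δ₀ c₀ R₀ e₁ : ℝ, 0 < δ₀ ∧ 0 < c₀ ∧ 0 < R₀ ∧ 0 < e₁ ∧ ∀ j : I,
      (zeroFieldSettingBond a Mb g (φ j)).regular → (zeroFieldSettingBond a Mb g (φ j)).bigBlocks →
        0 < (zeroFieldSettingBond a Mb g (φ j)).e → (zeroFieldSettingBond a Mb g (φ j)).e ≤ e₁ →
          Ineq19_110 (zeroFieldSettingBond a Mb g (φ j)) α δ₀ c₀ R₀ ∧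
            Ineq111_112 (zeroFieldSettingBond a Mb g (φ j)) α δ₀ c₀ R₀ := by
  obtain ⟨δ₀, c₀, R₀, e₁, hδ, hc, hR, he, H⟩ := h
  refine ⟨δ₀, c₀, R₀, e₁, hδ, hc, hR, he, fun j hreg hbig he0 he1 => ?_⟩
  obtain ⟨h1, h2⟩ := H j hreg hbig he0 he1
  exact ⟨ineq19_110_bond_of_B a Mb g (φ j) h1, ineq111_112_bond_of_B a Mb g (φ j) h2⟩

/-- hence the typed leaf `B4.ThmPrinted` itself transfers from the verbatim carrier to the bond convention on any
family of zero-field instances (contrapositively: every refutation of the bond-convention leaf on a family refutes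
the verbatim leaf on the same family). [folklore] -/
theorem thmPrinted_bond_of_B {I : Type} (φ : I → ZeroFieldInstance d) (a : ℝ) (Mb : ℕ)
    (g : ∀ i : ZeroFieldInstance d, (↥i.R → ℝ) → ℝ)
    (h : ThmPrinted (fun j => zeroFieldSettingB a Mb g (φ j))) :
    ThmPrinted (fun j => zeroFieldSettingBond a Mb g (φ j)) :=
  fun α hα => leafClause_bond_of_B φ a Mb g (h α hα)

/-- the same for node 13's `0 ≤ α` restriction `ThmPrintedNN`. [folklore] -/
theorem thmPrintedNN_bond_of_B {I : Type} (φ : I → ZeroFieldInstance d) (a : ℝ) (Mb : ℕ)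
    (g : ∀ i : ZeroFieldInstance d, (↥i.R → ℝ) → ℝ)
    (h : ThmPrintedNN (fun j => zeroFieldSettingB a Mb g (φ j))) :
    ThmPrintedNN (fun j => zeroFieldSettingBond a Mb g (φ j)) :=
  fun α hα0 hα1 => leafClause_bond_of_B φ a Mb g (h α hα0 hα1)

/-- **THE ENDPOINT IS CONVENTION-FREE**: over ANY index of zero-field instances (any regions), the `α = 0` clause of
the typed leaf holds in node 12's bond convention IF AND ONLY IF it holds in b04's verbatim carrier (constants
`c₀ ↦ 2c₀` forward by §2, unchanged backward by §7). [cite: Balaban1983RegularityDecay, Theorem p. 573 (1.9)–(1.12),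
case A = 0, endpoint α = 0: the two typed conventions agree] -/
theorem leafClause_zero_bond_iff_B {I : Type*} (φ : I → ZeroFieldInstance d) (a : ℝ) (Mb : ℕ)
    (g : ∀ i : ZeroFieldInstance d, (↥i.R → ℝ) → ℝ) :
    (∃ δ₀ c₀ R₀ e₁ : ℝ, 0 < δ₀ ∧ 0 < c₀ ∧ 0 < R₀ ∧ 0 < e₁ ∧ ∀ j : I,
      (zeroFieldSettingBond a Mb g (φ j)).regular → (zeroFieldSettingBond a Mb g (φ j)).bigBlocks →
        0 < (zeroFieldSettingBond a Mb g (φ j)).e → (zeroFieldSettingBond a Mb g (φ j)).e ≤ e₁ →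
          Ineq19_110 (zeroFieldSettingBond a Mb g (φ j)) 0 δ₀ c₀ R₀ ∧
            Ineq111_112 (zeroFieldSettingBond a Mb g (φ j)) 0 δ₀ c₀ R₀) ↔
    (∃ δ₀ c₀ R₀ e₁ : ℝ, 0 < δ₀ ∧ 0 < c₀ ∧ 0 < R₀ ∧ 0 < e₁ ∧ ∀ j : I,
      (zeroFieldSettingB a Mb g (φ j)).regular → (zeroFieldSettingB a Mb g (φ j)).bigBlocks →
        0 < (zeroFieldSettingB a Mb g (φ j)).e → (zeroFieldSettingB a Mb g (φ j)).e ≤ e₁ →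
          Ineq19_110 (zeroFieldSettingB a Mb g (φ j)) 0 δ₀ c₀ R₀ ∧
            Ineq111_112 (zeroFieldSettingB a Mb g (φ j)) 0 δ₀ c₀ R₀) :=
  ⟨fun h => leafClause_zero_of_bond φ a Mb g h, fun h => leafClause_bond_of_B φ a Mb g h⟩

/-! ## §8 (v1.1) The per-clause verdict on `nestFamB` for `0 < α < 1`: the defect is the `δG` Hölder clause alone -/

section PerClause

variable {ℓ : ℕ} {m2plus : ℝ}

/-- **(1.9)–(1.10) HOLD VERBATIM ON THE NESTED FAMILY FOR `0 ≤ α < 1`** (b04's unguarded carrier): each member's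
inner region IS a member of node 12's box family (`nestFamB … i = boxFamB … i.toBox` definitionally), on which node 14
proved the verbatim (1.9)–(1.10) up to the faces (`B4Ineq19ZeroBoxFace.ineq19_110_boxFamB`).
[cite: Balaban1983RegularityDecay, Theorem p. 573 (1.9)–(1.10), case A = 0, Ω a box, 0 ≤ α < 1, verbatim carrier] -/
theorem ineq19_110_nestFamB (hℓ : 1 ≤ ℓ) {a : ℝ} (ha : 0 < a) (Mb : ℕ)
    (g : ∀ i : ZeroFieldInstance d, (↥i.R → ℝ) → ℝ) {α : ℝ} (hα0 : 0 ≤ α) (hα1 : α < 1) :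
    ∃ δ₀ c₀ : ℝ, 0 < δ₀ ∧ 0 < c₀ ∧ ∀ (R₀ : ℝ) (i : NestInst d ℓ m2plus),
      Ineq19_110 (nestFamB ℓ m2plus a Mb g i) α δ₀ c₀ R₀ := by
  obtain ⟨δ₀, c₀, hδ, hc, h⟩ := ineq19_110_boxFamB (d := d) (m2plus := m2plus) hℓ a ha Mb g α hα0 hα1
  exact ⟨δ₀, c₀, hδ, hc, fun R₀ i => h R₀ i.toBox⟩

/-- **THE PER-CLAUSE VERDICT ON `nestFamB` FOR `0 < α < 1`** (`L ≥ 2`, `a > 0`, `m²₊ ≥ 0`, `Mb ≥ 1`, `0 ≤ g`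
admissible): (i) the verbatim (1.9)–(1.10) HOLD with one pair of constants (node 14); (ii) the full (1.11)–(1.12)
HOLD in node 13's bond convention with one pair of constants (`thm_nestFam`; in particular the two one-point
(1.10)·(1.12) clauses, whose fields are identical in both carriers, hold verbatim — node 13 `ineq112_nestFamB`);
(iii) for EVERY choice of constants some member meeting the typed antecedents violates the verbatim
`Ineq111_112` (node 17's face witness).  So on nested boxes the failure of the `α`-clause of `B4.ThmPrinted` in
b04's carrier for `0 < α < 1` (§5) sits in the unguarded `δG`-Hölder field (1.11) ALONE.
[cite: Balaban1983RegularityDecay, Theorem p. 573 (1.9)–(1.12), case A = 0, Ω ⊂ Ω₀ boxes, 0 < α < 1 — clause by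
clause in the two typed conventions; NOT a statement about the printed theorem] -/
theorem perClause_nestFamB (hℓ : 1 ≤ ℓ) (hm2 : 0 ≤ m2plus) {a : ℝ} (ha : 0 < a) {Mb : ℕ} (hMb : 1 ≤ Mb)
    {g : ∀ i : ZeroFieldInstance d, (↥i.R → ℝ) → ℝ} (hg0 : ∀ i f, 0 ≤ g i f)
    (hg1 : ∀ (i : ZeroFieldInstance d) (f : ↥i.R → ℝ),
      (outR i.R i.R₀).Nonempty → (supp f).Nonempty → g i f ≤ bdist i.n i.hsub f)
    (μ : Fin (d + 1)) {α : ℝ} (hα0 : 0 < α) (hα1 : α < 1) :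
    (∃ δ₀ c₀ : ℝ, 0 < δ₀ ∧ 0 < c₀ ∧ ∀ (R₀ : ℝ) (i : NestInst d ℓ m2plus),
      Ineq19_110 (nestFamB ℓ m2plus a Mb g i) α δ₀ c₀ R₀) ∧
    (∃ δ₀ c₀ : ℝ, 0 < δ₀ ∧ 0 < c₀ ∧ ∀ (R₀ : ℝ) (i : NestInst d ℓ m2plus),
      Ineq19_110 (nestFam ℓ m2plus a Mb g i) α δ₀ c₀ R₀ ∧ Ineq111_112 (nestFam ℓ m2plus a Mb g i) α δ₀ c₀ R₀) ∧
    (∀ (δ₀ : ℝ), 0 ≤ δ₀ → ∀ (c₀ R₀ e₁ : ℝ), ∃ i : NestInst d ℓ m2plus,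
      (nestFamB ℓ m2plus a Mb g i).regular ∧ (nestFamB ℓ m2plus a Mb g i).bigBlocks ∧
        (nestFamB ℓ m2plus a Mb g i).e = e₁ ∧ ¬ Ineq111_112 (nestFamB ℓ m2plus a Mb g i) α δ₀ c₀ R₀) :=
  ⟨ineq19_110_nestFamB hℓ ha Mb g hα0.le hα1, thm_nestFam (m2plus := m2plus) hℓ a ha Mb hg1 α hα0.le hα1,
    fun _ hδ c₀ R₀ e₁ => exists_member_violating hℓ hm2 ha hMb hg0 μ hα0 hδ c₀ R₀ e₁⟩

/-- consequently, for `0 < α < 1` NO uniform pair of constants makes the verbatim `Ineq111_112` hold on the whole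
nested family, although the verbatim `Ineq19_110` has one (the contrast in one line). [folklore] -/
theorem ineq19_not_ineq111_nestFamB (hℓ : 1 ≤ ℓ) (hm2 : 0 ≤ m2plus) {a : ℝ} (ha : 0 < a) {Mb : ℕ} (hMb : 1 ≤ Mb)
    {g : ∀ i : ZeroFieldInstance d, (↥i.R → ℝ) → ℝ} (hg0 : ∀ i f, 0 ≤ g i f) (μ : Fin (d + 1))
    {α : ℝ} (hα0 : 0 < α) (hα1 : α < 1) :
    (∃ δ₀ c₀ : ℝ, 0 < δ₀ ∧ 0 < c₀ ∧ ∀ (R₀ : ℝ) (i : NestInst d ℓ m2plus),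
      Ineq19_110 (nestFamB ℓ m2plus a Mb g i) α δ₀ c₀ R₀) ∧
    ¬ (∃ δ₀ c₀ : ℝ, 0 < δ₀ ∧ 0 < c₀ ∧ ∀ (R₀ : ℝ) (i : NestInst d ℓ m2plus),
      Ineq111_112 (nestFamB ℓ m2plus a Mb g i) α δ₀ c₀ R₀) := by
  refine ⟨ineq19_110_nestFamB hℓ ha Mb g hα0.le hα1, ?_⟩
  rintro ⟨_, c₀, hδ, -, h⟩
  obtain ⟨i, -, -, -, hi⟩ := exists_member_violating hℓ hm2 ha hMb hg0 μ hα0 hδ.le c₀ 1 1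
  exact hi (h 1 i)

end PerClause

/-! ### Non-vacuity of §7–§8 at `d + 1 = 4`, `L = 2`, `a = 1`, `m²₊ = 0`, `Mb = 1`, default carrier -/

section

/-- the endpoint is convention-free on the four-dimensional nested-box instances (`φ = NestInst.toZF`). -/
example :
    (∃ δ₀ c₀ R₀ e₁ : ℝ, 0 < δ₀ ∧ 0 < c₀ ∧ 0 < R₀ ∧ 0 < e₁ ∧ ∀ i : NestInst 3 1 0,
      (nestFam (d := 3) 1 0 1 1 (fun i f => bdist i.n i.hsub f) i).regular →
        (nestFam (d := 3) 1 0 1 1 (fun i f => bdist i.n i.hsub f) i).bigBlocks →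
        0 < (nestFam (d := 3) 1 0 1 1 (fun i f => bdist i.n i.hsub f) i).e →
          (nestFam (d := 3) 1 0 1 1 (fun i f => bdist i.n i.hsub f) i).e ≤ e₁ →
          Ineq19_110 (nestFam (d := 3) 1 0 1 1 (fun i f => bdist i.n i.hsub f) i) 0 δ₀ c₀ R₀ ∧
            Ineq111_112 (nestFam (d := 3) 1 0 1 1 (fun i f => bdist i.n i.hsub f) i) 0 δ₀ c₀ R₀) ↔
    (∃ δ₀ c₀ R₀ e₁ : ℝ, 0 < δ₀ ∧ 0 < c₀ ∧ 0 < R₀ ∧ 0 < e₁ ∧ ∀ i : NestInst 3 1 0,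
      (nestFamB (d := 3) 1 0 1 1 (fun i f => bdist i.n i.hsub f) i).regular →
        (nestFamB (d := 3) 1 0 1 1 (fun i f => bdist i.n i.hsub f) i).bigBlocks →
        0 < (nestFamB (d := 3) 1 0 1 1 (fun i f => bdist i.n i.hsub f) i).e →
          (nestFamB (d := 3) 1 0 1 1 (fun i f => bdist i.n i.hsub f) i).e ≤ e₁ →
          Ineq19_110 (nestFamB (d := 3) 1 0 1 1 (fun i f => bdist i.n i.hsub f) i) 0 δ₀ c₀ R₀ ∧
            Ineq111_112 (nestFamB (d := 3) 1 0 1 1 (fun i f => bdist i.n i.hsub f) i) 0 δ₀ c₀ R₀) :=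
  leafClause_zero_bond_iff_B (d := 3) (fun i : NestInst 3 1 0 => i.toZF) 1 1 (fun i f => bdist i.n i.hsub f)

/-- at `α = 1/2` on the four-dimensional default family: the verbatim (1.9)–(1.10) have uniform constants, the
verbatim (1.11)–(1.12) have none. -/
example :
    (∃ δ₀ c₀ : ℝ, 0 < δ₀ ∧ 0 < c₀ ∧ ∀ (R₀ : ℝ) (i : NestInst 3 1 0),
      Ineq19_110 (nestFamB (d := 3) 1 0 1 1 (fun i f => bdist i.n i.hsub f) i) (1 / 2) δ₀ c₀ R₀) ∧
    ¬ (∃ δ₀ c₀ : ℝ, 0 < δ₀ ∧ 0 < c₀ ∧ ∀ (R₀ : ℝ) (i : NestInst 3 1 0),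
      Ineq111_112 (nestFamB (d := 3) 1 0 1 1 (fun i f => bdist i.n i.hsub f) i) (1 / 2) δ₀ c₀ R₀) :=
  ineq19_not_ineq111_nestFamB (d := 3) (m2plus := 0) le_rfl le_rfl one_pos le_rfl (fun i f => bdist_nonneg i f) 0
    (by norm_num) (by norm_num)

end

end

end Literature.MathematicalPhysics.QuantumFieldTheory.Balaban1983to89.B4ThmZeroNestAlphaZero
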